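import Literature.Probability.LatticeModels.IntervalBoltzmannTransferForm
import Literature.Probability.LatticeModels.TransferRatioBoundaryLimit
import HarnessLib

/-!
# Interval Gibbs ratios of nearest-neighbour chains become boundary-independent, uniformly on
# compact sets of boundary spins

Topic `Literature/Probability/LatticeModels`; theorems only (no definitions, no named facts).
Assembly of `IntervalBoltzmannTransferForm.lean` (the interval Boltzmann integral with its two
boundary bonds is `(T^N H)(u)`, `H(x) = ∫⁻ M(x,y) (T^N k(v,·))(y) w(y) dν`) and
`TransferRatioBoundaryLimit.lean` (such ratios converge uniformly on compact sets of boundary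
spins) for a one-dimensional nearest-neighbour model with a priori measure `ν`, one-site weight
`w` (`0 < w`, `∫⁻ w dν < ∞`) and a bounded, symmetric, strictly positive real bond kernel `K`
continuous in the boundary spin (`k = ofReal ∘ K`):

* `lmarginal_Icc_prod_range` — `∫⋯∫⁻_{a,…,a+n} ∏_{j≤n} g(σ_{a+j}) dν = (∫⁻ g dν)^{n+1}`;
* `exists_limit_lmarginal_interval_ratio` (**main**) — for an observable `0 ≤ Φ ≤ 1` read on
  the interior `{a+1, …, a+n+1}` of the window `{a, …, a+n+2}` there is `L ∈ ℝ` such that the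
  finite-volume Gibbs ratios
  `∫⋯∫⁻_Λ Φ e^{-H_Λ} / ∫⋯∫⁻_Λ e^{-H_Λ}`, `Λ = {a-i, …, a+n+3+i}`,
  `e^{-H_Λ} = ∏_{x∈Λ} w(σ_x) ∏_{y=a-i-1}^{a+n+3+i} k(σ_y, σ_{y+1})` (boundary bonds included),
  are within `ε` of `L` for all large `i`, uniformly over the boundary conditions `η` whose two
  boundary spins `η_{a-i-1}`, `η_{a+n+i+4}` lie in a given compact set.

This is the finite-volume half of the uniqueness of the Gibbs state of one-dimensional models
with strictly positive Hilbert–Schmidt transfer operators among states with tight one-site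
marginals (Georgii 2011, Thm 10.25 and §11.1; Cassandro–Olivieri–Pellegrinotti–Presutti 1978, §2);
the abstract DLR step is `DLRUniquenessCriterion.lean`. [cite: Georgii2011, Thm 10.25 and §11.1]
-/

noncomputable section

open MeasureTheory Set Function Finset Filter
open scoped ENNReal

namespace Literature.Probability.LatticeModels

variable {S : Type*} [MeasurableSpace S] {ν : Measure S}

/-! ### Marginal integral of a product of one-site functions -/

/-- `∫⋯∫⁻_{a,…,a+n} ∏_{j≤n} g(σ_{a+j}) dν^{⊗} = (∫⁻ g dν)^{n+1}` (same induction as the chain lemma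
`OscillatorChain.lmarginal_prod_range`, for a general one-site space). [folklore] -/
theorem lmarginal_Icc_prod_range [SigmaFinite ν] {g : S → ℝ≥0∞} (hg : Measurable g) (a : ℤ)
    (n : ℕ) (η : ℤ → S) :
    (∫⋯∫⁻_Finset.Icc a (a + n), (fun σ : ℤ → S => ∏ j ∈ Finset.range (n + 1), g (σ (a + j)))
      ∂fun _ : ℤ => ν) η = (∫⁻ z, g z ∂ν) ^ (n + 1) := by
  -- adapted from `OscillatorChain.lmarginal_prod_range` (InfiniteChainMarkovSuperstable.lean)
  induction n generalizing η with
  | zero =>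
    rw [show a + ((0 : ℕ) : ℤ) = a by simp, show Finset.Icc a a = {a} from Finset.Icc_self a,
      lmarginal_singleton]
    simp
  | succ n ih =>
    have hset : Finset.Icc a (a + ↑(n + 1)) = insert (a + n + 1) (Finset.Icc a (a + n)) := by
      ext i; simp only [Finset.mem_insert, Finset.mem_Icc]; push_cast; omega
    have hnot : a + (n : ℤ) + 1 ∉ Finset.Icc a (a + n) := by
      simp only [Finset.mem_Icc]; omega
    have hmeas : Measurable fun σ : ℤ → S => ∏ j ∈ Finset.range (n + 1 + 1), g (σ (a + j)) :=
      Finset.measurable_prod _ fun j _ => hg.comp (measurable_pi_apply _)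
    rw [hset, lmarginal_insert' _ hmeas hnot]
    have hinner : (fun σ : ℤ → S => ∫⁻ y, ∏ j ∈ Finset.range (n + 1 + 1),
        g ((Function.update σ (a + n + 1) y) (a + j)) ∂ν) =
        fun σ => (∏ j ∈ Finset.range (n + 1), g (σ (a + j))) * ∫⁻ z, g z ∂ν := by
      funext σ
      have hval : ∀ y, ∏ j ∈ Finset.range (n + 1 + 1), g ((Function.update σ (a + n + 1) y) (a + j)) =
          (∏ j ∈ Finset.range (n + 1), g (σ (a + j))) * g y := by
        intro y
        rw [Finset.prod_range_succ]
        congr 1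
        · refine Finset.prod_congr rfl fun j hj => ?_
          rw [Finset.mem_range] at hj
          rw [Function.update_of_ne (by omega)]
        · rw [show a + ((n + 1 : ℕ) : ℤ) = a + n + 1 by push_cast; ring, Function.update_self]
      simp_rw [hval]
      rw [lintegral_const_mul _ hg]
    have hmeas' : Measurable fun σ : ℤ → S => ∏ j ∈ Finset.range (n + 1), g (σ (a + j)) :=
      Finset.measurable_prod _ fun j _ => hg.comp (measurable_pi_apply _)
    rw [hinner, lmarginal_mul_const_right _ hmeas', ih, ← pow_succ]

/-! ### The insertion kernels of a window observable -/

variable {k : S → S → ℝ≥0∞} {w : S → ℝ≥0∞} {B : ℤ → ℕ → (ℤ → S) → ℝ≥0∞}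
  {T : (S → ℝ≥0∞) → (S → ℝ≥0∞)}

/-- **The insertion kernel of a window observable, as a function of the two end spins.** For
`Φ` read on the interior `I = {a+1, …, a+n+1}` the quantity
`M(x, y) = ∫⋯∫⁻_I Φ · B (a+1) n · k(x, σ_{a+1}) · k(σ_{a+n+1}, y)` is realised by freezing the end
sites `a`, `a+n+2` of ANY base configuration to `x`, `y`; this realisation is jointly measurable
and does not depend on the base configuration. [folklore] -/
theorem insertionKernel_spec [SigmaFinite ν] (hk : Measurable (uncurry k)) (hw : Measurable w)
    (hB : ∀ a n σ, B a n σ = (∏ j ∈ Finset.range n, k (σ (a + j)) (σ (a + j + 1))) *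
      ∏ j ∈ Finset.range (n + 1), w (σ (a + j)))
    {a : ℤ} {n : ℕ} {Φ : (ℤ → S) → ℝ≥0∞} (hΦm : Measurable Φ)
    (hΦd : DependsOn Φ (↑(Finset.Icc (a + 1) (a + 1 + n)) : Set ℤ)) (η₀ : ℤ → S) :
    Measurable (uncurry fun x y => (∫⋯∫⁻_Finset.Icc (a + 1) (a + 1 + n),
        (fun σ => Φ σ * B (a + 1) n σ * k (σ a) (σ (a + 1)) * k (σ (a + 1 + n)) (σ (a + n + 2)))
        ∂fun _ : ℤ => ν) (update (update η₀ a x) (a + n + 2) y)) ∧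
      ∀ (η : ℤ → S) (x y : S), (∫⋯∫⁻_Finset.Icc (a + 1) (a + 1 + n),
        (fun σ => Φ σ * B (a + 1) n σ * k (σ a) (σ (a + 1)) * k (σ (a + 1 + n)) (σ (a + n + 2)))
        ∂fun _ : ℤ => ν) (update (update η₀ a x) (a + n + 2) y) =
        (∫⋯∫⁻_Finset.Icc (a + 1) (a + 1 + n),
          (fun σ => Φ σ * B (a + 1) n σ * k x (σ (a + 1)) * k (σ (a + 1 + n)) y)
          ∂fun _ : ℤ => ν) η := by
  classical
  set I : Finset ℤ := Finset.Icc (a + 1) (a + 1 + n) with hI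
  have haI : a ∉ I := by simp [hI]
  have hqI : a + (n : ℤ) + 2 ∉ I := by simp only [hI, Finset.mem_Icc]; omega
  have haq : a ≠ a + n + 2 := by omega
  have hF : Measurable fun σ : ℤ → S => Φ σ * B (a + 1) n σ * k (σ a) (σ (a + 1)) *
      k (σ (a + 1 + n)) (σ (a + n + 2)) :=
    ((hΦm.mul (measurable_B hk hw hB _ _)).mul (measurable_kernel_eval hk _ _)).mul
      (measurable_kernel_eval hk _ _)
  refine ⟨?_, fun η x y => ?_⟩
  · have hmap : Measurable fun p : S × S => update (update η₀ a p.1) (a + n + 2) p.2 :=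
      measurable_update'.comp (((measurable_update η₀).comp measurable_fst).prodMk measurable_snd)
    exact (hF.lmarginal (fun _ : ℤ => ν)).comp hmap
  · unfold lmarginal
    refine lintegral_congr fun ζ => ?_
    set base : ℤ → S := update (update η₀ a x) (a + n + 2) y with hbase
    have h1 : updateFinset base I ζ a = x := by
      simp [updateFinset, haI, hbase, update_of_ne haq]
    have h2 : updateFinset base I ζ (a + n + 2) = y := by
      simp [updateFinset, hqI, hbase]
    have hΦ : Φ (updateFinset base I ζ) = Φ (updateFinset η I ζ) :=
      dependsOn_apply_updateFinset_eq hΦd base η ζ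
    have hBB : B (a + 1) n (updateFinset base I ζ) = B (a + 1) n (updateFinset η I ζ) :=
      dependsOn_apply_updateFinset_eq (dependsOn_B hB (a + 1) n) base η ζ
    have h3 : updateFinset base I ζ (a + 1) = updateFinset η I ζ (a + 1) := by
      have : a + 1 ∈ I := by simp [hI]
      simp [updateFinset, this]
    have h4 : updateFinset base I ζ (a + 1 + n) = updateFinset η I ζ (a + 1 + n) := by
      have : a + 1 + (n : ℤ) ∈ I := by simp [hI]
      simp [updateFinset, this]
    dsimp only
    rw [h1, h2, hΦ, hBB, h3, h4]

/-! ### Boundary-independence of the interval Gibbs ratios -/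

/-- **Interval Gibbs ratios converge uniformly on compact sets of boundary spins.** Let `ν ≠ 0`
be σ-finite on the first-countable topological measurable space `S`, `w` a measurable, nowhere
vanishing one-site weight with `∫⁻ w dν < ∞`, `K` a jointly measurable, symmetric, strictly
positive real bond kernel bounded by `C` and continuous in its first variable, `k = ofReal ∘ K`,
`B`, `T` the window weights and transfer operator, and `Φ ≤ 1` a measurable observable read on
the interior `{a+1, …, a+n+1}`. Then there is `L ∈ ℝ` such that for every compact `C'` and
`ε > 0` there is `i₀` with
`|(∫⋯∫⁻_Λ Φ e^{-H_Λ} / ∫⋯∫⁻_Λ e^{-H_Λ})(η).toReal - L| < ε`,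
`Λ = {a-i, …, a+n+3+i}`, `e^{-H_Λ}(σ) = ∏_{x∈Λ} w(σ_x) ∏_{y=a-i-1}^{a+n+3+i} k(σ_y, σ_{y+1})`, for all
`i ≥ i₀` and all `η` with `η_{a-i-1}, η_{a+n+i+4} ∈ C'` (Georgii 2011, Thm 10.25 / §11.1: transfer
operator, Jentzsch's spectral gap, power iteration). [cite: Georgii2011, Thm 10.25 and §11.1] -/
theorem exists_limit_lmarginal_interval_ratio [TopologicalSpace S] [FirstCountableTopology S]
    [SigmaFinite ν] (hν : ν ≠ 0) (hw : Measurable w) (hwi : ∫⁻ y, w y ∂ν ≠ ∞)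
    (hwpos : ∀ y, w y ≠ 0) {K : S → S → ℝ} {C : ℝ} (hK : StronglyMeasurable (uncurry K))
    (hKc : ∀ y, Continuous fun u => K u y) (hC : ∀ x y, ‖K x y‖ ≤ C)
    (hsymm : ∀ x y, K x y = K y x) (hpos : ∀ x y, 0 < K x y)
    (hk : ∀ x y, k x y = ENNReal.ofReal (K x y))
    (hB : ∀ a n σ, B a n σ = (∏ j ∈ Finset.range n, k (σ (a + j)) (σ (a + j + 1))) *
      ∏ j ∈ Finset.range (n + 1), w (σ (a + j)))
    (hT : ∀ f z, T f z = ∫⁻ y, k z y * f y * w y ∂ν)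
    {a : ℤ} {n : ℕ} {Φ : (ℤ → S) → ℝ≥0∞} (hΦm : Measurable Φ)
    (hΦd : DependsOn Φ (↑(Finset.Icc (a + 1) (a + 1 + n)) : Set ℤ)) (hΦ1 : ∀ σ, Φ σ ≤ 1) :
    ∃ L : ℝ, ∀ Cpt : Set S, IsCompact Cpt → ∀ ε : ℝ, 0 < ε → ∃ i₀ : ℕ, ∀ i : ℕ, i₀ ≤ i →
      ∀ η : ℤ → S, η (a - i - 1) ∈ Cpt → η (a + ((n + 2 : ℕ) : ℤ) + i + 2) ∈ Cpt →
        |((∫⋯∫⁻_Finset.Icc (a - i) (a + ((n + 2 : ℕ) : ℤ) + 1 + i),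
            (fun σ => Φ σ * ((∏ x ∈ Finset.Icc (a - i) (a + ((n + 2 : ℕ) : ℤ) + 1 + i), w (σ x)) *
              ∏ y ∈ Finset.Icc (a - i - 1) (a + ((n + 2 : ℕ) : ℤ) + 1 + i), k (σ y) (σ (y + 1))))
            ∂fun _ : ℤ => ν) η /
          (∫⋯∫⁻_Finset.Icc (a - i) (a + ((n + 2 : ℕ) : ℤ) + 1 + i),
            (fun σ => (∏ x ∈ Finset.Icc (a - i) (a + ((n + 2 : ℕ) : ℤ) + 1 + i), w (σ x)) *
              ∏ y ∈ Finset.Icc (a - i - 1) (a + ((n + 2 : ℕ) : ℤ) + 1 + i), k (σ y) (σ (y + 1)))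
            ∂fun _ : ℤ => ν) η).toReal - L| < ε := by
  classical
  -- an empty spin space makes the statement vacuous
  by_cases hS : Nonempty (ℤ → S)
  swap
  · exact ⟨0, fun Cpt _ ε _ => ⟨0, fun i _ η => (hS ⟨η⟩).elim⟩⟩
  obtain ⟨η₀⟩ := hS
  -- `ℝ≥0∞` data
  have hkm : Measurable (uncurry k) := by
    rw [show uncurry k = fun p => ENNReal.ofReal (uncurry K p) from funext fun p => hk p.1 p.2]
    exact ENNReal.measurable_ofReal.comp hK.measurable
  have hsym : ∀ z y, k z y = k y z := fun z y => by rw [hk, hk, hsymm]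
  have hkpos : ∀ z y, 0 < k z y := fun z y => by rw [hk]; exact ENNReal.ofReal_pos.2 (hpos z y)
  have hCb : ∀ x y, K x y ≤ C := fun x y =>
    (le_abs_self _).trans ((Real.norm_eq_abs _).symm.le.trans (hC x y))
  have hkC : ∀ z y, k z y ≤ ENNReal.ofReal C := fun z y => by rw [hk]; exact ENNReal.ofReal_le_ofReal (hCb z y)
  have hw0 : ν.withDensity w ≠ 0 := by
    intro h0
    have h1 : ν.withDensity w univ = 0 := by rw [h0]; rfl
    rw [withDensity_apply _ MeasurableSet.univ, Measure.restrict_univ, lintegral_eq_zero_iff hw] at h1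
    have h2 : ∀ᵐ y ∂ν, False := by
      filter_upwards [h1] with y hy using hwpos y hy
    exact hν (ae_eq_bot.1 (eventually_false_iff_eq_bot.1 h2))
  have hνu : ν univ ≠ 0 := fun h => hν (Measure.measure_univ_eq_zero.1 h)
  -- the two insertion kernels (observable `Φ` and observable `1`)
  set I : Finset ℤ := Finset.Icc (a + 1) (a + 1 + n) with hI
  have hΦ1m : Measurable fun _ : ℤ → S => (1 : ℝ≥0∞) := measurable_const
  have hΦ1d : DependsOn (fun _ : ℤ → S => (1 : ℝ≥0∞)) (↑(Finset.Icc (a + 1) (a + 1 + n)) : Set ℤ) :=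
    fun _ _ _ => rfl
  obtain ⟨hMm, hM⟩ := insertionKernel_spec (ν := ν) hkm hw hB hΦm hΦd η₀
  obtain ⟨hM₁m, hM₁⟩ := insertionKernel_spec (ν := ν) hkm hw hB hΦ1m hΦ1d η₀
  -- a common finite bound
  set Cst : ℝ≥0∞ := ENNReal.ofReal C ^ (n + 2) * (∫⁻ y, w y ∂ν) ^ (n + 1) with hCst
  have hCst_top : Cst ≠ ∞ :=
    ENNReal.mul_ne_top (ENNReal.pow_ne_top ENNReal.ofReal_ne_top) (ENNReal.pow_ne_top hwi)
  set CM : ℝ := Cst.toReal with hCMdef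
  have hCM : 0 ≤ CM := ENNReal.toReal_nonneg
  have hofCM : ENNReal.ofReal CM = Cst := ENNReal.ofReal_toReal hCst_top
  -- pointwise bound of the integrand of `M₁`
  have hF₁le : ∀ (x y : S) (σ : ℤ → S),
      (1 : ℝ≥0∞) * B (a + 1) n σ * k x (σ (a + 1)) * k (σ (a + 1 + n)) y ≤
        (∏ j ∈ Finset.range (n + 1), w (σ (a + 1 + j))) * ENNReal.ofReal C ^ (n + 2) := by
    intro x y σ
    rw [one_mul, hB]
    have h1 : ∏ j ∈ Finset.range n, k (σ (a + 1 + j)) (σ (a + 1 + j + 1)) ≤ ENNReal.ofReal C ^ n := by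
      have h := Finset.prod_le_pow_card (Finset.range n)
        (fun j : ℕ => k (σ (a + 1 + j)) (σ (a + 1 + j + 1))) (ENNReal.ofReal C) fun j _ => hkC _ _
      rwa [Finset.card_range] at h
    calc (∏ j ∈ Finset.range n, k (σ (a + 1 + j)) (σ (a + 1 + j + 1))) *
          (∏ j ∈ Finset.range (n + 1), w (σ (a + 1 + j))) * k x (σ (a + 1)) * k (σ (a + 1 + n)) y
        ≤ ENNReal.ofReal C ^ n * (∏ j ∈ Finset.range (n + 1), w (σ (a + 1 + j))) *
            ENNReal.ofReal C * ENNReal.ofReal C := by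
          gcongr
          · exact hkC _ _
          · exact hkC _ _
      _ = (∏ j ∈ Finset.range (n + 1), w (σ (a + 1 + j))) * ENNReal.ofReal C ^ (n + 2) := by ring
  have hM₁b : ∀ x y, (∫⋯∫⁻_Finset.Icc (a + 1) (a + 1 + n),
      (fun σ => (1 : ℝ≥0∞) * B (a + 1) n σ * k x (σ (a + 1)) * k (σ (a + 1 + n)) y)
      ∂fun _ : ℤ => ν) η₀ ≤ Cst := by
    intro x y
    have hmeas : Measurable fun σ : ℤ → S => ∏ j ∈ Finset.range (n + 1), w (σ (a + 1 + j)) :=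
      Finset.measurable_prod _ fun j _ => hw.comp (measurable_pi_apply _)
    calc (∫⋯∫⁻_Finset.Icc (a + 1) (a + 1 + n),
          (fun σ => (1 : ℝ≥0∞) * B (a + 1) n σ * k x (σ (a + 1)) * k (σ (a + 1 + n)) y)
          ∂fun _ : ℤ => ν) η₀
        ≤ (∫⋯∫⁻_Finset.Icc (a + 1) (a + 1 + n),
            (fun σ => (∏ j ∈ Finset.range (n + 1), w (σ (a + 1 + j))) * ENNReal.ofReal C ^ (n + 2))
            ∂fun _ : ℤ => ν) η₀ := lmarginal_mono (fun σ => hF₁le x y σ) η₀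
      _ = Cst := by
          rw [lmarginal_mul_const_right _ hmeas, lmarginal_Icc_prod_range hw (a + 1) n η₀, hCst,
            mul_comm]
  have hM₁b' : ∀ x y, (∫⋯∫⁻_Finset.Icc (a + 1) (a + 1 + n),
      (fun σ => (1 : ℝ≥0∞) * B (a + 1) n σ * k (σ a) (σ (a + 1)) * k (σ (a + 1 + n)) (σ (a + n + 2)))
      ∂fun _ : ℤ => ν) (update (update η₀ a x) (a + n + 2) y) ≤ ENNReal.ofReal CM := by
    intro x y
    rw [hM₁ η₀ x y, hofCM]
    exact hM₁b x y
  have hMb' : ∀ x y, (∫⋯∫⁻_Finset.Icc (a + 1) (a + 1 + n),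
      (fun σ => Φ σ * B (a + 1) n σ * k (σ a) (σ (a + 1)) * k (σ (a + 1 + n)) (σ (a + n + 2)))
      ∂fun _ : ℤ => ν) (update (update η₀ a x) (a + n + 2) y) ≤ ENNReal.ofReal CM := by
    intro x y
    rw [hM η₀ x y, hofCM]
    refine le_trans (lmarginal_mono (fun σ => ?_) η₀) (hM₁b x y)
    dsimp only
    rw [one_mul]
    calc Φ σ * B (a + 1) n σ * k x (σ (a + 1)) * k (σ (a + 1 + n)) y
        ≤ 1 * B (a + 1) n σ * k x (σ (a + 1)) * k (σ (a + 1 + n)) y := by gcongr; exact hΦ1 σ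
      _ = B (a + 1) n σ * k x (σ (a + 1)) * k (σ (a + 1 + n)) y := by rw [one_mul]
  -- positivity of `M₁`
  have hM₁pos : ∀ x y, 0 < (∫⋯∫⁻_Finset.Icc (a + 1) (a + 1 + n),
      (fun σ => (1 : ℝ≥0∞) * B (a + 1) n σ * k (σ a) (σ (a + 1)) * k (σ (a + 1 + n)) (σ (a + n + 2)))
      ∂fun _ : ℤ => ν) (update (update η₀ a x) (a + n + 2) y) := by
    intro x y
    have hF₁ : Measurable fun σ : ℤ → S => (1 : ℝ≥0∞) * B (a + 1) n σ * k (σ a) (σ (a + 1)) *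
        k (σ (a + 1 + n)) (σ (a + n + 2)) :=
      ((hΦ1m.mul (measurable_B hkm hw hB _ _)).mul (measurable_kernel_eval hkm _ _)).mul
        (measurable_kernel_eval hkm _ _)
    have hBpos : ∀ σ : ℤ → S, B (a + 1) n σ ≠ 0 := fun σ => by
      rw [hB]
      exact mul_ne_zero (Finset.prod_ne_zero_iff.2 fun j _ => (hkpos _ _).ne')
        (Finset.prod_ne_zero_iff.2 fun j _ => hwpos _)
    unfold lmarginal
    refine (lintegral_pos_iff_support (hF₁.comp measurable_updateFinset)).2 ?_
    have hsupp : support ((fun σ : ℤ → S => (1 : ℝ≥0∞) * B (a + 1) n σ * k (σ a) (σ (a + 1)) *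
        k (σ (a + 1 + n)) (σ (a + n + 2))) ∘
        updateFinset (update (update η₀ a x) (a + n + 2) y) (Finset.Icc (a + 1) (a + 1 + n))) =
        univ := by
      refine eq_univ_of_forall fun ζ => ?_
      rw [mem_support, Function.comp_apply, one_mul]
      exact mul_ne_zero (mul_ne_zero (hBpos _) (hkpos _ _).ne') (hkpos _ _).ne'
    rw [hsupp, Measure.pi_univ]
    exact pos_iff_ne_zero.2 (Finset.prod_ne_zero_iff.2 fun _ _ => hνu)
  -- the analytic input
  obtain ⟨L, hL⟩ := exists_limit_iterate_transfer_ratio (ν := ν) hw hwi hw0 hK hKc hC hsymm hpos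
    hk hT hMm hM₁m hCM hMb' hM₁b' hM₁pos
  refine ⟨L, fun Cpt hCpt ε hε => ?_⟩
  obtain ⟨N₀, hN₀⟩ := hL Cpt hCpt ε hε
  refine ⟨N₀, fun i hi η hu hv => ?_⟩
  -- both marginal integrals in transfer-operator form
  have hnum := lmarginal_interval_eq_iterate_transfer (ν := ν) hkm hw hsym hB hT hΦm hΦd i η
    (hM η) hMm
  have hden := lmarginal_interval_eq_iterate_transfer (ν := ν) hkm hw hsym hB hT hΦ1m hΦ1d i η
    (hM₁ η) hM₁m
  have hgoal := hN₀ (i + 1) (by omega) (η (a - i - 1)) (η (a + ((n + 2 : ℕ) : ℤ) + i + 2)) hu hv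
  simp only [one_mul] at hden hgoal
  rw [hnum, hden]
  exact hgoal

end Literature.Probability.LatticeModels

end
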